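import Summits.CriticalPhenomena.PercolationContinuityZ3.Theorems.PercNearOneGluingNoHeavyQuantRootDecFloorSplit
import HarnessLib

/-!
# QUANT lane R8 — "at most one open": the calculus of `AMO[T, q]` (part A of the PAIRWISE-COMPLETING family of Conjecture DIB\*)

builds on p205010 (kernel theorem, internal audit signed; external expert review pending)

Support file (`--supports stmt-CriticalPhenomena-4575`), QUANT lane typer seat prim-quant-stmt (gen 20).  Theorems only; local notation.

For closure probabilities `q : κ → ℝ` and a finset `T` of blobs, `AMO[T, q] = ∏_{k∈T} q k + Σ_{k∈T} (1 − q k)·∏_{l∈T∖k} q l` is the probability that AT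
MOST ONE blob of `T` is open (independent blobs, blob `k` open with probability `1 − q k`).

* `Quant.IndepBlob.amo_insert` — conditioning on one blob: `AMO[insert a T, q] = q a·AMO[T, q] + (1 − q a)·∏_{T} q` (`a ∉ T`).
* `Quant.IndepBlob.prod_le_amo`, `amo_nonneg`, `amo_le_one` — range.
* `Quant.IndepBlob.amo_mono` — MONOTONE in the closure probabilities: `0 ≤ q ≤ q' ≤ 1` on `T` ⟹ `AMO[T, q] ≤ AMO[T, q']`.
* `Quant.IndepBlob.amo_insert_le`, `amo_union_le`, `amo_le_of_subset` — MONOTONE in the set: `S ⊆ T` ⟹ `AMO[T, q] ≤ AMO[S, q]`.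
* `Quant.RootDec.term_ge_one_sub_amo` — **THE PAIR-COMPLETION TERM RULE**: gates in `[0,1]`; a finset `T` of blobs any two of which complete at the sure
  part `s` (`j + 1 ≤ s + a k + a l` for `k ≠ l` in `T`) ⟹ `1 − AMO[T, 1 − g] ≤ TERM[s, a, g, j]` (induction on `T` by `term_cond`; the one-more-suffices
  branch is rule ∨ `term_ge_disj_giants`).  With `|T| = 3` this is `term_ge_twoOfThree` of `…QuantIndepBlobThreeBlobs`.
[this work]; the gluing rows served [cite: KozmaNitzan2024, Conjecture 3 (p. 15)]; product weights [cite: Grimmett1999, §1.3 p. 10].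
-/

namespace Summit.CriticalPhenomena.PercolationContinuityZ3.Theorems

namespace Quant

namespace IndepBlob

open Finset

variable {κ : Type} [DecidableEq κ]

/-- probability that at most one blob of `T` is open, closure probabilities `q` -/
local notation3 "AMO[" T ", " q "]" =>
  (∏ k ∈ (T : Finset κ), (q : κ → ℝ) k) + ∑ k ∈ (T : Finset κ), (1 - (q : κ → ℝ) k) * ∏ l ∈ (T : Finset κ).erase k, (q : κ → ℝ) l

/-! ### 1. Conditioning on one blob, range -/

/-- **Conditioning on one blob**: `AMO[insert a T, q] = q a·AMO[T, q] + (1 − q a)·∏_{T} q` for `a ∉ T`. [this work] -/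
theorem amo_insert (T : Finset κ) (q : κ → ℝ) (a : κ) (ha : a ∉ T) :
    AMO[insert a T, q] = q a * AMO[T, q] + (1 - q a) * ∏ l ∈ T, q l := by
  rw [Finset.prod_insert ha, Finset.sum_insert ha, Finset.erase_insert ha]
  have hsum : ∑ k ∈ T, (1 - q k) * ∏ l ∈ (insert a T).erase k, q l =
      q a * ∑ k ∈ T, (1 - q k) * ∏ l ∈ T.erase k, q l := by
    rw [Finset.mul_sum]
    refine Finset.sum_congr rfl fun k hk => ?_
    have hka : k ≠ a := fun h => ha (h ▸ hk)
    rw [Finset.erase_insert_of_ne hka.symm, Finset.prod_insert (fun h => ha (Finset.mem_of_mem_erase h))]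
    ring
  rw [hsum]
  ring

/-- `∏_{T} q ≤ AMO[T, q]` (the sum is nonnegative for `q ∈ [0,1]` on `T`). [this work] -/
theorem prod_le_amo (T : Finset κ) (q : κ → ℝ) (hq : ∀ k ∈ T, 0 ≤ q k ∧ q k ≤ 1) :
    ∏ l ∈ T, q l ≤ AMO[T, q] :=
  le_add_of_nonneg_right (Finset.sum_nonneg fun k hk =>
    mul_nonneg (sub_nonneg.2 (hq k hk).2) (Finset.prod_nonneg fun l hl => (hq l (Finset.mem_of_mem_erase hl)).1))

/-- `0 ≤ AMO[T, q]` for `q ∈ [0,1]` on `T`. [this work] -/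
theorem amo_nonneg (T : Finset κ) (q : κ → ℝ) (hq : ∀ k ∈ T, 0 ≤ q k ∧ q k ≤ 1) : 0 ≤ AMO[T, q] :=
  (Finset.prod_nonneg fun l hl => (hq l hl).1).trans (prod_le_amo T q hq)

/-- `AMO[T, q] ≤ 1` for `q ∈ [0,1]` on `T`. [this work] -/
theorem amo_le_one (T : Finset κ) (q : κ → ℝ) (hq : ∀ k ∈ T, 0 ≤ q k ∧ q k ≤ 1) : AMO[T, q] ≤ 1 := by
  induction T using Finset.induction_on with
  | empty => simp
  | insert a T ha ih =>
    have hqT : ∀ k ∈ T, 0 ≤ q k ∧ q k ≤ 1 := fun k hk => hq k (Finset.mem_insert_of_mem hk)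
    rw [amo_insert T q a ha]
    have h1 := ih hqT
    have h2 : ∏ l ∈ T, q l ≤ 1 := Finset.prod_le_one (fun l hl => (hqT l hl).1) fun l hl => (hqT l hl).2
    have hqa := hq a (Finset.mem_insert_self a T)
    nlinarith [mul_le_mul_of_nonneg_left h1 hqa.1, mul_le_mul_of_nonneg_left h2 (sub_nonneg.2 hqa.2)]

/-! ### 2. Monotonicity -/

/-- **Monotone in the closure probabilities**: `0 ≤ q k ≤ q' k ≤ 1` on `T` ⟹ `AMO[T, q] ≤ AMO[T, q']` (closing blobs more often makes "at most
one open" likelier). [this work] -/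
theorem amo_mono (T : Finset κ) (q q' : κ → ℝ) (hq : ∀ k ∈ T, 0 ≤ q k ∧ q k ≤ q' k ∧ q' k ≤ 1) :
    AMO[T, q] ≤ AMO[T, q'] := by
  induction T using Finset.induction_on with
  | empty => simp
  | insert a T ha ih =>
    have hqT : ∀ k ∈ T, 0 ≤ q k ∧ q k ≤ q' k ∧ q' k ≤ 1 := fun k hk => hq k (Finset.mem_insert_of_mem hk)
    have hq'T : ∀ k ∈ T, 0 ≤ q' k ∧ q' k ≤ 1 := fun k hk => ⟨(hqT k hk).1.trans (hqT k hk).2.1, (hqT k hk).2.2⟩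
    rw [amo_insert T q a ha, amo_insert T q' a ha]
    have hA := ih hqT
    have hN : ∏ l ∈ T, q l ≤ ∏ l ∈ T, q' l :=
      Finset.prod_le_prod (fun l hl => (hqT l hl).1) fun l hl => (hqT l hl).2.1
    have hNA : ∏ l ∈ T, q' l ≤ AMO[T, q'] := prod_le_amo T q' hq'T
    have hqa := hq a (Finset.mem_insert_self a T)
    have h1 : q a * AMO[T, q] ≤ q a * AMO[T, q'] := mul_le_mul_of_nonneg_left hA hqa.1
    have h2 : (1 - q a) * ∏ l ∈ T, q l ≤ (1 - q a) * ∏ l ∈ T, q' l :=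
      mul_le_mul_of_nonneg_left hN (by linarith [hqa.2.1, hqa.2.2])
    have h3 : 0 ≤ (q' a - q a) * (AMO[T, q'] - ∏ l ∈ T, q' l) :=
      mul_nonneg (sub_nonneg.2 hqa.2.1) (sub_nonneg.2 hNA)
    nlinarith [h1, h2, h3]

/-- Adding a blob lowers `AMO`: `AMO[insert a T, q] ≤ AMO[T, q]` (`q ∈ [0,1]` on `insert a T`). [this work] -/
theorem amo_insert_le (T : Finset κ) (q : κ → ℝ) (a : κ) (hq : ∀ k ∈ insert a T, 0 ≤ q k ∧ q k ≤ 1) :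
    AMO[insert a T, q] ≤ AMO[T, q] := by
  by_cases ha : a ∈ T
  · rw [Finset.insert_eq_of_mem ha]
  have hqT : ∀ k ∈ T, 0 ≤ q k ∧ q k ≤ 1 := fun k hk => hq k (Finset.mem_insert_of_mem hk)
  rw [amo_insert T q a ha]
  have hNA := prod_le_amo T q hqT
  have hqa := hq a (Finset.mem_insert_self a T)
  nlinarith [mul_le_mul_of_nonneg_left hNA (sub_nonneg.2 hqa.2)]

/-- `AMO[S ∪ U, q] ≤ AMO[S, q]` (`q ∈ [0,1]` on `S ∪ U`). [this work] -/
theorem amo_union_le (S U : Finset κ) (q : κ → ℝ) (hq : ∀ k ∈ S ∪ U, 0 ≤ q k ∧ q k ≤ 1) :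
    AMO[S ∪ U, q] ≤ AMO[S, q] := by
  induction U using Finset.induction_on with
  | empty => simp
  | insert a U _ ih =>
    have hq' : ∀ k ∈ S ∪ U, 0 ≤ q k ∧ q k ≤ 1 := fun k hk =>
      hq k (by rw [Finset.union_insert]; exact Finset.mem_insert_of_mem hk)
    rw [Finset.union_insert]
    exact (amo_insert_le (S ∪ U) q a (by rw [← Finset.union_insert]; exact hq)).trans (ih hq')

/-- **Monotone in the set**: `S ⊆ T` ⟹ `AMO[T, q] ≤ AMO[S, q]` (`q ∈ [0,1]` on `T`). [this work] -/
theorem amo_le_of_subset (S T : Finset κ) (hST : S ⊆ T) (q : κ → ℝ) (hq : ∀ k ∈ T, 0 ≤ q k ∧ q k ≤ 1) :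
    AMO[T, q] ≤ AMO[S, q] := by
  have hT : T = S ∪ (T \ S) := (Finset.union_sdiff_of_subset hST).symm
  rw [hT]
  exact amo_union_le S (T \ S) q (by rw [← hT]; exact hq)

end IndepBlob

namespace RootDec

open Finset

variable {κ : Type} [Fintype κ] [DecidableEq κ]

/-- product-Bernoulli weight of the set `W` of open blobs (as in `…QuantRootReduction`) -/
local notation3 "wt[" g ", " W "]" => ∏ k, (if k ∈ (W : Finset κ) then (g : κ → ℝ) k else 1 - (g : κ → ℝ) k)

/-- the TERM tail `P(s + Σ_{k open} a k ≥ j+1)` (as in `…QuantRootReduction`) -/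
local notation3 "TERM[" s ", " a ", " g ", " j "]" =>
  ∑ W : Finset κ, wt[g, W] * (if (j : ℕ) + 1 ≤ (s : ℕ) + ∑ k ∈ W, (a : κ → ℕ) k then (1 : ℝ) else 0)

/-- probability that at most one blob of `T` is open, closure probabilities `q` (as in `Quant.IndepBlob`) -/
local notation3 "AMO[" T ", " q "]" =>
  (∏ k ∈ (T : Finset κ), (q : κ → ℝ) k) + ∑ k ∈ (T : Finset κ), (1 - (q : κ → ℝ) k) * ∏ l ∈ (T : Finset κ).erase k, (q : κ → ℝ) l

/-! ### 3. The pair-completion TERM rule -/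

/-- **THE PAIR-COMPLETION TERM RULE.**  Gates in `[0,1]`; `T` a finset of blobs any two of which complete at the sure part `s`
(`j + 1 ≤ s + a k + a l` for `k ≠ l` in `T`) ⟹ `1 − AMO[T, 1 − g] ≤ TERM[s, a, g, j]`: the term is at least the probability that at least two
blobs of `T` are open.  (Induction on `T`: condition on a blob `k₀ ∈ T` (`term_cond`); if it is open, one more blob of `T` suffices — rule ∨
`term_ge_disj_giants`; if it is closed, the induction hypothesis; recombine with `amo_insert`.) [this work] -/
theorem term_ge_one_sub_amo (g : κ → ℝ) (j : ℕ) (hg : ∀ k, 0 ≤ g k ∧ g k ≤ 1) (T : Finset κ) :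
    ∀ (s : ℕ) (a : κ → ℕ), (∀ k ∈ T, ∀ l ∈ T, k ≠ l → j + 1 ≤ s + a k + a l) →
      1 - AMO[T, fun k => 1 - g k] ≤ TERM[s, a, g, j] := by
  induction T using Finset.induction_on with
  | empty =>
    intro s a _
    simp only [Finset.prod_empty, Finset.sum_empty, add_zero, sub_self]
    exact term_nonneg s a g j hg
  | insert k₀ T hk₀ ih =>
    intro s a hpair
    rw [IndepBlob.amo_insert T (fun k => 1 - g k) k₀ hk₀, term_cond s a g j k₀]
    -- open branch: every blob of `T` completes `k₀`
    have hA : 1 - ∏ l ∈ T, (1 - g l) ≤ TERM[s + a k₀, Function.update a k₀ 0, g, j] := by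
      refine term_ge_disj_giants (s + a k₀) (Function.update a k₀ 0) g j hg T fun l hl => ?_
      have hl0 : l ≠ k₀ := fun h => hk₀ (h ▸ hl)
      rw [Function.update_of_ne hl0]
      exact hpair k₀ (Finset.mem_insert_self _ _) l (Finset.mem_insert_of_mem hl) hl0.symm
    -- closed branch: induction hypothesis for the system without `k₀`
    have hB : 1 - AMO[T, fun k => 1 - g k] ≤ TERM[s, Function.update a k₀ 0, g, j] := by
      refine ih s (Function.update a k₀ 0) fun k hk l hl hkl => ?_
      rw [Function.update_of_ne (fun h => hk₀ (h ▸ hk) : k ≠ k₀), Function.update_of_ne (fun h => hk₀ (h ▸ hl) : l ≠ k₀)]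
      exact hpair k (Finset.mem_insert_of_mem hk) l (Finset.mem_insert_of_mem hl) hkl
    have h1 := mul_le_mul_of_nonneg_left hA (hg k₀).1
    have h2 := mul_le_mul_of_nonneg_left hB (sub_nonneg.2 (hg k₀).2)
    have e : (1 : ℝ) - (1 - g k₀) = g k₀ := by ring
    rw [e]
    nlinarith [h1, h2]

end RootDec

end Quant

end Summit.CriticalPhenomena.PercolationContinuityZ3.Theorems
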